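import Mathlib
import HarnessLib
import Summits.HubbardSuperconductivity.HubbardSuperconductivity.Theorems.KLProgrammeKLRegimeEngineScaleOneSrcPackageW
import Summits.HubbardSuperconductivity.HubbardSuperconductivity.Theorems.KLProgrammeKLRegimeEngineScaleZeroKernelNormsWtDoors
import Summits.HubbardSuperconductivity.HubbardSuperconductivity.Theorems.KLProgrammeKLRegimeTwoVolumeTowerBaseTransferWDoors

/-!
# Route `KLProgramme` — K3 VL child (stmt-HubbardSuperconductivity-23356), atom HUV-W (`stub_vl_srcUV`, windowed currency), LEVEL 0:
# the DOORS and the LAW-UNIT MATCHING of `srcPinnedSumW_one_of_bounds` (cell gate-hubbard-kl, seat p3 g21)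

p3 g20's `srcPinnedSumW_one_of_bounds` (ONE determinant-bounded step at `Λ₁ = e₀/4`, read through the WINDOWED doubled analysis
`klSrcAnalysisAtW … 0`) holds modulo: the time-moment witness `C_T`, the space moment `X`, the Λ₁ covariance bracket `Ā`, the frame size `k̄K`,
two smallness conditions and the window's `c₂`.  This file finishes the level-`0` supply line (pattern of p3 g9's `…ScaleZeroKernelNormsWtDoors`):
§0 regime algebra (`β(1 + log 4M) ≤ M` from `klEngM₃ ≤ M`; the Λ₁ bracket `≤ D₁·(1 + ΣGfr)⁴`, `D₁` absolute; the smallness from two product doors);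
§1 **`srcPinnedSumW_one_of_doors`** (`X := 8(klE4X0+1)`, `k̄K := klE4KapF R·|U| + 2(c/log 4)·klE4Mom R`, doors `klEngC₃6`/`klEngU₀6`);
§2 **`srcPinnedSumW_one_klSrcBudget_of_le_CE`** — the LAW-UNIT MATCHING: for every `Q` with `32e⁹t_W²Ā ≤ Q.CE` (`t_W = 2klIsoT + C_T + 8(klE4X0+1) + 2 + 72c₂`)
and every `A₀ ≥ max 1 (2t_W²(e⁵k̄K + 4e⁹κ₁²|U|))` (`κ₁ = √(2(7+6047)) + √6047`), every sub-sum of the windowed level-`0` pinned fibre is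
`≤ klSrcBudget P Q U (fun _ _ => A₀) 1 s m` in EVERY degree (degree `≤ 2` = the free constant; `2p ≥ 4` by `wtBudget_dominates_biGraded`, `Klam|U| ≤ ε_1`);
§3 **`exists_srcPinnedSumW_one_klSrcBudget`** — the packaged FRAME-GENERIC `∃` form in the atom's quantifier order (`∀ P R, WF → ∃ CE₀, ∃ c₀, ∀ c, ∃ U₀,
∀ μ U β, ∃ A₀ ≥ 1, ∀ L M ≥ (klEngL₃, klEngM₃), ∀ K, FrameOK R U (nScales β) μ K → ∀ Q, CE₀ ≤ Q.CE → …`; `A₀`, thresholds, `CE₀` are `K`-free — the VL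
producer takes `K := K_top` with `FrameOK` from its tower hypothesis).  Level `0` only; the all-species sums dominate the `s = 1, 2` species sums of the
lead's `SourceProfilesAtLevF … (srcWindowFamily L M) 0 0 1`.  Everything is proved; no definitions, no named facts, no sorry.  Nothing asserts HUV, any
stub, VL, K3 or superconductivity.
[cite: BenfattoGiulianiMastropietro2006, §2.7 (2.77)–(2.81), §2.9 (4.3)–(4.8), §3 (3.2)–(3.8)]
-/

noncomputable section

namespace Summit.HubbardSuperconductivity.HubbardSuperconductivity.Theorems.EngineV8

set_option linter.dupNamespace false -- summit = problem name (single-conjunct summit), D-0017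

open Real Finset Complex Literature.MathematicalPhysics.QuantumLattice Literature.Probability.LatticeModels Literature.Probability.LatticeModels.BattleFederbush Literature.MathematicalPhysics.QuantumLattice.GrassmannAlgebra
open Summit.HubbardSuperconductivity.HubbardSuperconductivity.Theorems.KLRegimeSplit Summit.HubbardSuperconductivity.HubbardSuperconductivity.Theorems.DispersionFlow
open Summit.HubbardSuperconductivity.HubbardSuperconductivity.Theorems.KLProgrammeLegKernels Summit.HubbardSuperconductivity.HubbardSuperconductivity.Theorems.ScaleZeroDecay
open Summit.HubbardSuperconductivity.HubbardSuperconductivity.Theorems.TwoVolumeSource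
open scoped ComplexConjugate

/-! ## §0 Regime algebra -/

section Regime

/-- `1 + log x ≤ 2√x` for `x > 0` (from `log y ≤ y − 1` at `y = √x`). [folklore] -/
theorem one_add_log_le_two_mul_sqrt {x : ℝ} (hx : 0 < x) : 1 + Real.log x ≤ 2 * Real.sqrt x := by
  have h1 : Real.log (Real.sqrt x) ≤ Real.sqrt x - 1 := Real.log_le_sub_one_of_pos (Real.sqrt_pos.2 hx)
  have h2 : Real.log x = 2 * Real.log (Real.sqrt x) := by
    conv_lhs => rw [← Real.sq_sqrt hx.le]
    rw [Real.log_pow]; norm_num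
  rw [h2]; linarith

/-- **The window's side condition is automatic in the engine regime**: `klBetaMin ≤ β` and `klEngM₃ β U L ≤ M` give `β(1 + log 4M) ≤ M`
(`klEngM₃ ≥ 2¹⁰(⌈β⌉+1)² ≥ 64β²` and `1 + log 4M ≤ 4√M`). [folklore] -/
theorem beta_log_le_of_klEngM₃ {β U : ℝ} {L M : ℕ} (hβ : klBetaMin ≤ β) (hM : klEngM₃ β U L ≤ M) :
    β * (1 + Real.log ((2 * (2 * M) : ℕ) : ℝ)) ≤ M := by
  have hβ128 : (128 : ℝ) ≤ β := by simpa [klBetaMin] using hβ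
  have hM64 : 64 * β ^ 2 ≤ (M : ℝ) := by
    unfold klEngM₃ at hM
    have hcast : ((2 ^ 10 * (⌈|β|⌉₊ + 1) ^ 2 * (L + 1) ^ 2 : ℕ) : ℝ) ≤ (M : ℝ) := by exact_mod_cast hM
    push_cast at hcast
    have hb : β ≤ (⌈|β|⌉₊ : ℝ) + 1 := by linarith [(Nat.le_ceil _ : |β| ≤ (⌈|β|⌉₊ : ℝ)), le_abs_self β]
    have hb2 : β ^ 2 ≤ ((⌈|β|⌉₊ : ℝ) + 1) ^ 2 := pow_le_pow_left₀ (by linarith) hb 2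
    have hL1 : (1 : ℝ) ≤ ((L : ℝ) + 1) ^ 2 := by nlinarith [(Nat.cast_nonneg L : (0 : ℝ) ≤ L)]
    nlinarith
  have hMpos : (0 : ℝ) < M := by nlinarith
  have hN4 : (((2 * (2 * M) : ℕ) : ℝ)) = 4 * M := by push_cast; ring
  have hs : Real.sqrt (4 * (M : ℝ)) = 2 * Real.sqrt M := by
    rw [Real.sqrt_mul (by norm_num), show (4 : ℝ) = 2 ^ 2 by norm_num, Real.sqrt_sq (by norm_num)]
  have hlog := one_add_log_le_two_mul_sqrt (x := 4 * (M : ℝ)) (by positivity)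
  have hsq : 8 * β ≤ Real.sqrt M := by rw [Real.le_sqrt (by positivity) hMpos.le]; nlinarith
  rw [hN4, hs] at *
  nlinarith [Real.mul_self_sqrt hMpos.le, Real.sqrt_nonneg (M : ℝ)]

/-- Pure real numbers: `A + T + 2(S + V·(4608·g·t)) ≤ (|A| + |T| + 2|S| + 2|V|·13824 + 1)·g` for `g ≥ 1`, `0 ≤ t ≤ 3`. [folklore] -/
theorem bracket_le_abs_mul (A T S V : ℝ) {g t : ℝ} (hg : 1 ≤ g) (ht0 : 0 ≤ t) (ht : t ≤ 3) :
    A + T + 2 * (S + V * (4608 * g * t)) ≤ (|A| + |T| + 2 * |S| + 2 * |V| * (4608 * 3) + 1) * g := by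
  have hg0 : 0 ≤ g := zero_le_one.trans hg
  have h1 : A ≤ |A| * g := (le_abs_self A).trans (le_mul_of_one_le_right (abs_nonneg _) hg)
  have h2 : T ≤ |T| * g := (le_abs_self T).trans (le_mul_of_one_le_right (abs_nonneg _) hg)
  have h3 : S ≤ |S| * g := (le_abs_self S).trans (le_mul_of_one_le_right (abs_nonneg _) hg)
  have h4 : V * (4608 * g * t) ≤ |V| * (4608 * 3) * g := by
    have h41 : V * (4608 * g * t) ≤ |V| * (4608 * g * t) := mul_le_mul_of_nonneg_right (le_abs_self V) (by positivity)
    have h42 : |V| * (4608 * g * t) ≤ |V| * (4608 * g * 3) := mul_le_mul_of_nonneg_left (by nlinarith) (abs_nonneg _)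
    linarith
  nlinarith [h1, h2, h3, h4, hg0]

/-- **The Λ₁ covariance bracket of `srcPinnedSumW_one_of_bounds` is at most an ABSOLUTE constant times `(1 + ΣGfr)⁴`** (cutoff profile
`klCutoffX5`; `|U| ≤ 1`, `(n_β+1)U² ≤ 1/2`). [folklore] -/
theorem exists_abarOne_le : ∃ D₁ : ℝ, 1 ≤ D₁ ∧ ∀ (R : RenConsts) (U : ℝ) (Nsc : ℕ), R.WF → |U| ≤ 1 → (((Nsc : ℕ) : ℝ) + 1) * U ^ 2 ≤ 1 / 2 →
    (14 * Real.sqrt ((1 / 2 + 12 / klScale klE0 1) *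
            (2 / klScale klE0 1 + 128 * Real.pi ^ 4 * (4 * (1110 : ℝ) + 6 * (32 / 3) + 2) ^ 2 / klScale klE0 1 +
              2 * Real.pi ^ 5 * (4 * (1110 : ℝ) + 6 * (32 / 3) + 2) ^ 2 / klScale klE0 1 ^ 2 + 1 +
              Real.pi ^ 4 * ((7 : ℝ) ^ 2 * (4 * (1110 : ℝ) + 6 * (32 / 3) + 2) * (2 / klScale klE0 1) + 7 * (2 * (32 / 3) + 1)) ^ 2 /
                klScale klE0 1 ^ 3))) + uvTimeMomentConst (klScale klE0 1) 7 32 +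
        2 * (uvSpaceMomentConst (klScale klE0 1) 1 (uvPieceSq (klScale klE0 1) (uvBaseQ klCutoffX5 (klScale klE0 1) 4) (uvBaseQ' klCutoffX5 (klScale klE0 1) 4)) +
          (1 / 4 * Real.sqrt (216 * (1 / klScale klE0 1 + 1 / 2)) *
              ∑ e : Fin 2 × Fin 2, (uvLinV (klScale klE0 1) (1 + (e.1 : ℕ) + (e.2 : ℕ)) *
                  (klCutoffX5 * ((1 + ((e.1 : ℕ) + (e.2 : ℕ)) + 2).factorial : ℝ) * (4 / klScale klE0 1) ^ (1 + ((e.1 : ℕ) + (e.2 : ℕ)) + 1)) +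
                uvLinD (klScale klE0 1) (1 + (e.1 : ℕ) + (e.2 : ℕ)) *
                  (klCutoffX5 * ((1 + ((e.1 : ℕ) + (e.2 : ℕ)) + 3).factorial : ℝ) * (4 / klScale klE0 1) ^ (1 + ((e.1 : ℕ) + (e.2 : ℕ)) + 2)))) *
            (4608 * (1 + R.Gfr 0 + R.Gfr 1 + R.Gfr 2 + R.Gfr 3) ^ 4 * ((((Nsc : ℕ) : ℝ) + 1) * U ^ 2 + 2 * |U|))) ≤
      D₁ * (1 + R.Gfr 0 + R.Gfr 1 + R.Gfr 2 + R.Gfr 3) ^ 4 := by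
  refine ⟨|14 * Real.sqrt ((1 / 2 + 12 / klScale klE0 1) *
            (2 / klScale klE0 1 + 128 * Real.pi ^ 4 * (4 * (1110 : ℝ) + 6 * (32 / 3) + 2) ^ 2 / klScale klE0 1 +
              2 * Real.pi ^ 5 * (4 * (1110 : ℝ) + 6 * (32 / 3) + 2) ^ 2 / klScale klE0 1 ^ 2 + 1 +
              Real.pi ^ 4 * ((7 : ℝ) ^ 2 * (4 * (1110 : ℝ) + 6 * (32 / 3) + 2) * (2 / klScale klE0 1) + 7 * (2 * (32 / 3) + 1)) ^ 2 /
                klScale klE0 1 ^ 3))| + |uvTimeMomentConst (klScale klE0 1) 7 32| +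
        2 * |uvSpaceMomentConst (klScale klE0 1) 1 (uvPieceSq (klScale klE0 1) (uvBaseQ klCutoffX5 (klScale klE0 1) 4) (uvBaseQ' klCutoffX5 (klScale klE0 1) 4))| +
        2 * |1 / 4 * Real.sqrt (216 * (1 / klScale klE0 1 + 1 / 2)) *
              ∑ e : Fin 2 × Fin 2, (uvLinV (klScale klE0 1) (1 + (e.1 : ℕ) + (e.2 : ℕ)) *
                  (klCutoffX5 * ((1 + ((e.1 : ℕ) + (e.2 : ℕ)) + 2).factorial : ℝ) * (4 / klScale klE0 1) ^ (1 + ((e.1 : ℕ) + (e.2 : ℕ)) + 1)) +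
                uvLinD (klScale klE0 1) (1 + (e.1 : ℕ) + (e.2 : ℕ)) *
                  (klCutoffX5 * ((1 + ((e.1 : ℕ) + (e.2 : ℕ)) + 3).factorial : ℝ) * (4 / klScale klE0 1) ^ (1 + ((e.1 : ℕ) + (e.2 : ℕ)) + 2)))| *
          (4608 * 3) + 1, le_add_of_nonneg_left (by positivity), fun R U Nsc hR hU1 hN => ?_⟩
  have hG : ∀ j, 0 ≤ R.Gfr j := hR.2.2
  have hg1 : (1 : ℝ) ≤ (1 + R.Gfr 0 + R.Gfr 1 + R.Gfr 2 + R.Gfr 3) ^ 4 := by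
    have : (1 : ℝ) ≤ 1 + R.Gfr 0 + R.Gfr 1 + R.Gfr 2 + R.Gfr 3 := by linarith [hG 0, hG 1, hG 2, hG 3]
    exact one_le_pow₀ this
  have ht : (((Nsc : ℕ) : ℝ) + 1) * U ^ 2 + 2 * |U| ≤ 3 := by linarith [abs_nonneg U]
  have ht0 : 0 ≤ (((Nsc : ℕ) : ℝ) + 1) * U ^ 2 + 2 * |U| := by positivity
  exact bracket_le_abs_mul _ _ _ _ hg1 ht0 ht

/-- **The two smallness conditions `θ_w ≤ 1/2` from two product doors** (pure real numbers): with `e ≥ 1`, `κ² ≥ 1`, `A ≥ 0`, `KF ≥ 1`, `Mom ≥ 0`,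
`U > 0`, `cl ≥ 0` (any real `Mom`), the doors `128e⁹κ²·A·KF·U ≤ 1` and `128e⁵·A·(Mom+1)·cl ≤ 1` give `16e⁵A(KF·U + 2cl·Mom) ≤ 1` and `64e⁹κ²A·U ≤ 1`. [folklore] -/
theorem thetaW_smallness_of_le {e κ A KF Mom U cl : ℝ} (he : 1 ≤ e) (hκ : 1 ≤ κ ^ 2) (hA : 0 ≤ A) (hKF : 1 ≤ KF)
    (hU : 0 < U) (hcl : 0 ≤ cl) (hUd : 128 * e ^ 9 * κ ^ 2 * A * KF * U ≤ 1) (hcd : 128 * e ^ 5 * A * (Mom + 1) * cl ≤ 1) :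
    16 * e ^ 5 * A * (KF * |U| + 2 * cl * Mom) ≤ 1 ∧ 64 * e ^ 9 * κ ^ 2 * A * |U| ≤ 1 := by
  have hUabs : |U| = U := abs_of_pos hU
  rw [hUabs]
  have he0 : 0 < e := lt_of_lt_of_le one_pos he
  have he4 : 1 ≤ e ^ 4 := one_le_pow₀ he
  have hbase : 0 ≤ 16 * e ^ 5 * A * (KF * U) := by positivity
  constructor
  · have t1 : 16 * e ^ 5 * A * (KF * U) ≤ 1 / 8 := by
      have hid : 16 * e ^ 5 * A * (KF * U) * (8 * (e ^ 4 * κ ^ 2)) = 128 * e ^ 9 * κ ^ 2 * A * KF * U := by ring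
      have hek : 1 ≤ e ^ 4 * κ ^ 2 := one_le_mul_of_one_le_of_one_le he4 hκ
      nlinarith
    have t2 : 16 * e ^ 5 * A * (2 * cl * Mom) ≤ 1 / 4 := by
      have h0 : 0 ≤ 128 * e ^ 5 * A * cl := by positivity
      nlinarith
    nlinarith
  · have hAU : 0 ≤ 64 * e ^ 9 * κ ^ 2 * A * U := by positivity
    nlinarith

/-- `Klam·|U| ≤ ε_1 = Klam(|U| + U²)` (`Klam ≥ 0`). [folklore] -/
theorem klam_abs_le_epsCoupling_one {P : SplitConsts} (hK : 0 ≤ P.Klam) (U : ℝ) : P.Klam * |U| ≤ epsCoupling P U 1 := by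
  unfold epsCoupling
  push_cast
  nlinarith [sq_nonneg U, abs_nonneg U]

end Regime

variable {L M : ℕ}

/-! ## §1 `srcPinnedSumW_one_of_bounds` under the doors (space moment, frame size and window side condition discharged) -/

/-- **HUV-W level `0` under the doors `c ≤ klEngC₃6 P R`, `U ≤ klEngU₀6 P R c`**: `srcPinnedSumW_one_of_bounds` with `X := 8(klE4X0 + 1)`,
`k̄K := klE4KapF R·|U| + 2(c/log 4)·klE4Mom R` and `β(1 + log 4M) ≤ M` discharged; the Λ₁ bracket `Ā` and its two smallness conditions are kept
(`t_W = 2klIsoT + C_T + 8(klE4X0+1) + (2 + 72c₂)`). [cite: BenfattoGiulianiMastropietro2006, §2.7 (2.77)–(2.81)] -/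
theorem srcPinnedSumW_one_of_doors {C_T : ℝ} (hCT0 : 0 ≤ C_T)
    (hCT : ∀ (L M : ℕ) [NeZero L] [NeZero M] (R : RenConsts) (U : ℝ) (N : ℕ) (μ : ℝ) (K : TrigPolyC4v),
      FrameOK R U N μ K → (∀ j, 0 ≤ R.Gfr j) → μ ∈ klWindowC → 16 / 15 * (R.Gfr 0 * |U|) ≤ 1 / 50 → (2 : ℝ) ^ 15 ≤ L →
      ∀ β : ℝ, klBetaMin ≤ β → β ≤ M → klE0 * β ≤ Real.pi * (2 * M - 13) →
      ∀ (ω : Fin (sectorCount 0)) (c : Fin 2),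
        1 / (|β| * (L : ℝ) ^ 2) *
            ∑ dw : TorusSite 1 (2 * (2 * M)) × TorusSite 2 L,
              (β / (2 * (2 * M) : ℕ) * cyclicDist (2 * (2 * M)) (dw.1 0) 0) *
                ‖∑ k : FreqMomentum L M, klAnisoFamily L M β μ K klE0 0 ω k *
                  (if c = 0 then torusChar (fun _ : Fin 1 => ((k.1 : ℕ) : ZMod (2 * (2 * M)))) dw.1 * torusChar k.2 dw.2 else conj (torusChar (fun _ : Fin 1 => ((k.1 : ℕ) : ZMod (2 * (2 * M)))) dw.1 * torusChar k.2 dw.2))‖ ≤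
          C_T * (M / β))
    {c₂ : ℝ} (hc₂ : ∀ x : ℝ, |iteratedDeriv 2 srcWindowFn x| ≤ c₂)
    (P : SplitConsts) (R : RenConsts) (c : ℝ) (hP : P.WF) (hR : R.WF2) (hc : 0 < c) (hc₆ : c ≤ klEngC₃6 P R)
    (μ : ℝ) (hμ : μ ∈ klWindowC) (U : ℝ) (hU : 0 < U) (hU₆ : U ≤ klEngU₀6 P R c) (β : ℝ) (hβ : klBetaMin ≤ β)
    (hβc : β ≤ Real.exp (c / U ^ 2)) (K : TrigPolyC4v) (hK : FrameOK R U (nScales β) μ K) (L M : ℕ) [NeZero L] [NeZero M]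
    (hL : klEngL₃ β U ≤ L) (hM : klEngM₃ β U L ≤ M)
    {Abar : ℝ}
    (hAbar : (14 * Real.sqrt ((1 / 2 + 12 / klScale klE0 1) *
            (2 / klScale klE0 1 + 128 * Real.pi ^ 4 * (4 * (1110 : ℝ) + 6 * (32 / 3) + 2) ^ 2 / klScale klE0 1 +
              2 * Real.pi ^ 5 * (4 * (1110 : ℝ) + 6 * (32 / 3) + 2) ^ 2 / klScale klE0 1 ^ 2 + 1 +
              Real.pi ^ 4 * ((7 : ℝ) ^ 2 * (4 * (1110 : ℝ) + 6 * (32 / 3) + 2) * (2 / klScale klE0 1) + 7 * (2 * (32 / 3) + 1)) ^ 2 /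
                klScale klE0 1 ^ 3))) + uvTimeMomentConst (klScale klE0 1) 7 32 +
        2 * (uvSpaceMomentConst (klScale klE0 1) 1 (uvPieceSq (klScale klE0 1) (uvBaseQ klCutoffX5 (klScale klE0 1) 4) (uvBaseQ' klCutoffX5 (klScale klE0 1) 4)) +
          (1 / 4 * Real.sqrt (216 * (1 / klScale klE0 1 + 1 / 2)) *
              ∑ e : Fin 2 × Fin 2, (uvLinV (klScale klE0 1) (1 + (e.1 : ℕ) + (e.2 : ℕ)) *
                  (klCutoffX5 * ((1 + ((e.1 : ℕ) + (e.2 : ℕ)) + 2).factorial : ℝ) * (4 / klScale klE0 1) ^ (1 + ((e.1 : ℕ) + (e.2 : ℕ)) + 1)) +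
                uvLinD (klScale klE0 1) (1 + (e.1 : ℕ) + (e.2 : ℕ)) *
                  (klCutoffX5 * ((1 + ((e.1 : ℕ) + (e.2 : ℕ)) + 3).factorial : ℝ) * (4 / klScale klE0 1) ^ (1 + ((e.1 : ℕ) + (e.2 : ℕ)) + 2)))) *
            (4608 * (1 + R.Gfr 0 + R.Gfr 1 + R.Gfr 2 + R.Gfr 3) ^ 4 * ((((nScales β : ℕ) : ℝ) + 1) * U ^ 2 + 2 * |U|))) ≤ Abar)
    (hθ1 : 16 * Real.exp 1 ^ 5 * Abar * (klE4KapF R * |U| + 2 * (c / Real.log 4) * klE4Mom R) ≤ 1)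
    (hθ2 : 64 * Real.exp 1 ^ 9 * (Real.sqrt (2 * (7 + 6047)) + Real.sqrt 6047) ^ 2 * Abar * |U| ≤ 1)
    (N : ℕ → ℝ) (hNodd : ∀ m, Odd m → 0 ≤ N m)
    (hN2 : 2 * (2 * klIsoT + C_T + 8 * (klE4X0 + 1) + (2 + 72 * c₂)) ^ 2 *
        (Real.exp 1 ^ 5 * (klE4KapF R * |U| + 2 * (c / Real.log 4) * klE4Mom R) +
          4 * Real.exp 1 ^ 9 * (Real.sqrt (2 * (7 + 6047)) + Real.sqrt 6047) ^ 2 * |U|) ≤ N 2)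
    (hNp : ∀ p, 2 ≤ p → 2 ^ p * (4 * Real.exp 1 ^ 9 * (Real.sqrt (2 * (7 + 6047)) + Real.sqrt 6047) ^ 4 * ((Real.sqrt (2 * (7 + 6047)) + Real.sqrt 6047))⁻¹ ^ (2 * p) *
        (2 * klIsoT + C_T + 8 * (klE4X0 + 1) + (2 + 72 * c₂)) ^ (2 * p) *
          (16 * Real.exp 1 ^ 9 * (Real.sqrt (2 * (7 + 6047)) + Real.sqrt 6047) ^ 2 * Abar * |U|) ^ (p - 2) * |U|) ≤ N (2 * p)) :
    ∀ (m : ℕ) (q : Fin m) (w : SrcLabel L M 0),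
      imagTimeWeight β M ^ (m - 1) *
        ∑ X ∈ univ.filter (fun X : Fin m → SrcLabel L M 0 => X q = w),
          klScaleWt L M β 0 ((univ.image X).image (srcLegPos L M (2 * (2 * M)))) *
            ‖kernel ℂ (ExteriorAlgebra.map (Matrix.toLin' (klSrcAnalysisAtW L M β μ K 0)) (klEffectiveAction L M β U μ K klE0 1)) m X‖ ≤ N m := by
  have hRwf : R.WF := hR.wf
  have hc₃ : c ≤ klEngC₃3 P R := hc₆.trans (klEngC₃6_le_klEngC₃3 P R)
  have hcD : c ≤ klE4C₃ R := hc₆.trans (klEngC₃6_le_klE4C₃ P R)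
  have hU₀ : U ≤ klEngU₀3 P R c := hU₆.trans (klEngU₀6_le_klEngU₀3 P R c)
  have hUD : U ≤ klE4U₀ R := hU₆.trans (klEngU₀6_le_klE4U₀ P R c)
  have hU1 : |U| ≤ 1 := abs_le_one_of_le_klEngU₀3 hU hU₀
  have hκU : 16 / 15 * (R.Gfr 0 * |U|) ≤ 1 / 50 := gfr0_abs_mul_le_of_le_klEngU₀3 hU hU₀
  obtain ⟨hL15, -, -, -, hβ3M, -⟩ := scaleZero_regime_sizes hβ hL hM
  have hN := nScales_succ_mul_sq_le (U := U) hc.le hβ hβc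
  have hX0 : 0 ≤ klE4X0 := uvSpaceMomentConst_nonneg _ _ _
  have hMlog : β * (1 + Real.log ((2 * (2 * M) : ℕ) : ℝ)) ≤ M := beta_log_le_of_klEngM₃ hβ hM
  exact srcPinnedSumW_one_of_bounds hCT0 hCT (X := 8 * (klE4X0 + 1)) (by positivity) P R c hP hR hc hc₃ μ hμ U hU hU₀ β hβ hβc K hK L M
    hL hM hc₂ hMlog one_le_klCutoffX5 norm_iteratedDeriv_salmhoferCutoff_le_klCutoffX5 hAbar
    (kKbar := klE4KapF R * |U| + 2 * (c / Real.log 4) * klE4Mom R) (kKbar_le hRwf hN) hθ1 hθ2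
    (fun ω c' => spaceMoment_klAnisoFamily_zero_le_of_doors hK hRwf hU hU1 hUD hc.le hcD hμ hκU hL15 hβ hβc hβ3M ω c') N hNodd hN2 hNp

/-! ## §2 The law-unit matching: the windowed level-`0` line at the budget `klSrcBudget P Q U (fun _ _ => A₀) 1` -/

/-- **HUV-W LEVEL 0 AT THE SOURCE BUDGET** — under the doors `c ≤ klEngC₃6 P R`, `U ≤ klEngU₀6 P R c`, for every bracket majorant `Ā ≥ 1` with its two
smallness conditions, every package `Q` with `32·e⁹·t_W²·Ā ≤ Q.CE` and every `A₀ ≥ max 1 (2t_W²(e⁵k̄K + 4e⁹κ₁²|U|))`: every sub-sum of the windowed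
level-`0` pinned fibre (in particular each source species) is within `klSrcBudget P Q U (fun _ _ => A₀) 1 s m`, in EVERY degree `m`.
[cite: BenfattoGiulianiMastropietro2006, §2.9 (4.3)–(4.8), §3 (3.2)–(3.8)] -/
theorem srcPinnedSumW_one_klSrcBudget_of_le_CE {C_T : ℝ} (hCT0 : 0 ≤ C_T)
    (hCT : ∀ (L M : ℕ) [NeZero L] [NeZero M] (R : RenConsts) (U : ℝ) (N : ℕ) (μ : ℝ) (K : TrigPolyC4v),
      FrameOK R U N μ K → (∀ j, 0 ≤ R.Gfr j) → μ ∈ klWindowC → 16 / 15 * (R.Gfr 0 * |U|) ≤ 1 / 50 → (2 : ℝ) ^ 15 ≤ L →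
      ∀ β : ℝ, klBetaMin ≤ β → β ≤ M → klE0 * β ≤ Real.pi * (2 * M - 13) →
      ∀ (ω : Fin (sectorCount 0)) (c : Fin 2),
        1 / (|β| * (L : ℝ) ^ 2) *
            ∑ dw : TorusSite 1 (2 * (2 * M)) × TorusSite 2 L,
              (β / (2 * (2 * M) : ℕ) * cyclicDist (2 * (2 * M)) (dw.1 0) 0) *
                ‖∑ k : FreqMomentum L M, klAnisoFamily L M β μ K klE0 0 ω k *
                  (if c = 0 then torusChar (fun _ : Fin 1 => ((k.1 : ℕ) : ZMod (2 * (2 * M)))) dw.1 * torusChar k.2 dw.2 else conj (torusChar (fun _ : Fin 1 => ((k.1 : ℕ) : ZMod (2 * (2 * M)))) dw.1 * torusChar k.2 dw.2))‖ ≤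
          C_T * (M / β))
    {c₂ : ℝ} (hc₂ : ∀ x : ℝ, |iteratedDeriv 2 srcWindowFn x| ≤ c₂)
    (P : SplitConsts) (R : RenConsts) (c : ℝ) (hP : P.WF) (hR : R.WF2) (hc : 0 < c) (hc₆ : c ≤ klEngC₃6 P R)
    (μ : ℝ) (hμ : μ ∈ klWindowC) (U : ℝ) (hU : 0 < U) (hU₆ : U ≤ klEngU₀6 P R c) (β : ℝ) (hβ : klBetaMin ≤ β)
    (hβc : β ≤ Real.exp (c / U ^ 2)) (K : TrigPolyC4v) (hK : FrameOK R U (nScales β) μ K) (L M : ℕ) [NeZero L] [NeZero M]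
    (hL : klEngL₃ β U ≤ L) (hM : klEngM₃ β U L ≤ M)
    {Abar : ℝ} (hAbar1 : 1 ≤ Abar)
    (hAbar : (14 * Real.sqrt ((1 / 2 + 12 / klScale klE0 1) *
            (2 / klScale klE0 1 + 128 * Real.pi ^ 4 * (4 * (1110 : ℝ) + 6 * (32 / 3) + 2) ^ 2 / klScale klE0 1 +
              2 * Real.pi ^ 5 * (4 * (1110 : ℝ) + 6 * (32 / 3) + 2) ^ 2 / klScale klE0 1 ^ 2 + 1 +
              Real.pi ^ 4 * ((7 : ℝ) ^ 2 * (4 * (1110 : ℝ) + 6 * (32 / 3) + 2) * (2 / klScale klE0 1) + 7 * (2 * (32 / 3) + 1)) ^ 2 /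
                klScale klE0 1 ^ 3))) + uvTimeMomentConst (klScale klE0 1) 7 32 +
        2 * (uvSpaceMomentConst (klScale klE0 1) 1 (uvPieceSq (klScale klE0 1) (uvBaseQ klCutoffX5 (klScale klE0 1) 4) (uvBaseQ' klCutoffX5 (klScale klE0 1) 4)) +
          (1 / 4 * Real.sqrt (216 * (1 / klScale klE0 1 + 1 / 2)) *
              ∑ e : Fin 2 × Fin 2, (uvLinV (klScale klE0 1) (1 + (e.1 : ℕ) + (e.2 : ℕ)) *
                  (klCutoffX5 * ((1 + ((e.1 : ℕ) + (e.2 : ℕ)) + 2).factorial : ℝ) * (4 / klScale klE0 1) ^ (1 + ((e.1 : ℕ) + (e.2 : ℕ)) + 1)) +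
                uvLinD (klScale klE0 1) (1 + (e.1 : ℕ) + (e.2 : ℕ)) *
                  (klCutoffX5 * ((1 + ((e.1 : ℕ) + (e.2 : ℕ)) + 3).factorial : ℝ) * (4 / klScale klE0 1) ^ (1 + ((e.1 : ℕ) + (e.2 : ℕ)) + 2)))) *
            (4608 * (1 + R.Gfr 0 + R.Gfr 1 + R.Gfr 2 + R.Gfr 3) ^ 4 * ((((nScales β : ℕ) : ℝ) + 1) * U ^ 2 + 2 * |U|))) ≤ Abar)
    (hθ1 : 16 * Real.exp 1 ^ 5 * Abar * (klE4KapF R * |U| + 2 * (c / Real.log 4) * klE4Mom R) ≤ 1)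
    (hθ2 : 64 * Real.exp 1 ^ 9 * (Real.sqrt (2 * (7 + 6047)) + Real.sqrt 6047) ^ 2 * Abar * |U| ≤ 1)
    (Q : EngConsts) (hCE : 32 * Real.exp 1 ^ 9 * (2 * klIsoT + C_T + 8 * (klE4X0 + 1) + (2 + 72 * c₂)) ^ 2 * Abar ≤ Q.CE)
    {A₀ : ℝ} (hA₀ : max 1 (2 * (2 * klIsoT + C_T + 8 * (klE4X0 + 1) + (2 + 72 * c₂)) ^ 2 *
        (Real.exp 1 ^ 5 * (klE4KapF R * |U| + 2 * (c / Real.log 4) * klE4Mom R) +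
          4 * Real.exp 1 ^ 9 * (Real.sqrt (2 * (7 + 6047)) + Real.sqrt 6047) ^ 2 * |U|)) ≤ A₀) :
    ∀ (s m : ℕ) (q : Fin m) (w : SrcLabel L M 0) (S : Finset (Fin m → SrcLabel L M 0)),
      S ⊆ univ.filter (fun X : Fin m → SrcLabel L M 0 => X q = w) →
      imagTimeWeight β M ^ (m - 1) *
        ∑ X ∈ S, klScaleWt L M β 0 ((univ.image X).image (srcLegPos L M (2 * (2 * M)))) *
            ‖kernel ℂ (ExteriorAlgebra.map (Matrix.toLin' (klSrcAnalysisAtW L M β μ K 0)) (klEffectiveAction L M β U μ K klE0 1)) m X‖ ≤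
        klSrcBudget P Q U (fun _ _ => A₀) 1 s m := by
  classical
  have hKl0 : 0 ≤ P.Klam := zero_le_one.trans hP.1
  have hβ0 : 0 < β := beta_pos_of_klBetaMin_le hβ
  have he1 : 1 ≤ Real.exp 1 := Real.one_le_exp (by norm_num)
  have hκ0 : 0 < (Real.sqrt (2 * (7 + 6047)) + Real.sqrt 6047) :=
    add_pos_of_pos_of_nonneg (Real.sqrt_pos.2 (by norm_num)) (Real.sqrt_nonneg _)
  have hA₀1 : 1 ≤ A₀ := (le_max_left _ _).trans hA₀
  have hA₀0 : 0 ≤ A₀ := zero_le_one.trans hA₀1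
  have hCE0 : 0 ≤ Q.CE := le_trans (by positivity) hCE
  intro s
  -- the budget `N m := klSrcBudget P Q U (fun _ _ => A₀) 1 s m`
  set N : ℕ → ℝ := fun m => klSrcBudget P Q U (fun _ _ => A₀) 1 s m with hN
  have hNodd : ∀ m, Odd m → 0 ≤ N m := fun m _ => klSrcBudget_nonneg hCE0 hKl0 U (fun _ _ => hA₀0) 1 s m
  have hN2 : 2 * (2 * klIsoT + C_T + 8 * (klE4X0 + 1) + (2 + 72 * c₂)) ^ 2 *
      (Real.exp 1 ^ 5 * (klE4KapF R * |U| + 2 * (c / Real.log 4) * klE4Mom R) +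
        4 * Real.exp 1 ^ 9 * (Real.sqrt (2 * (7 + 6047)) + Real.sqrt 6047) ^ 2 * |U|) ≤ N 2 := by
    have h2 : N 2 = A₀ := by rw [hN]; exact klSrcBudget_of_le_two P Q U _ 1 s le_rfl
    rw [h2]
    exact (le_max_right _ _).trans hA₀
  have hNp : ∀ p, 2 ≤ p → 2 ^ p * (4 * Real.exp 1 ^ 9 * (Real.sqrt (2 * (7 + 6047)) + Real.sqrt 6047) ^ 4 * ((Real.sqrt (2 * (7 + 6047)) + Real.sqrt 6047))⁻¹ ^ (2 * p) *
      (2 * klIsoT + C_T + 8 * (klE4X0 + 1) + (2 + 72 * c₂)) ^ (2 * p) *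
        (16 * Real.exp 1 ^ 9 * (Real.sqrt (2 * (7 + 6047)) + Real.sqrt 6047) ^ 2 * Abar * |U|) ^ (p - 2) * |U|) ≤ N (2 * p) := by
    intro p hp
    obtain ⟨p', rfl⟩ : ∃ p', p = p' + 2 := ⟨p - 2, by omega⟩
    have hNe : N (2 * (p' + 2)) = A₀ * klWtBudget P Q U 1 (2 * (p' + 2)) := by
      rw [hN]; exact klSrcBudget_of_two_lt P Q U _ 1 s (by omega)
    rw [hNe, klWtBudget_two_mul_of_two_le P Q U 1 hp, show p' + 2 - 2 = p' from rfl, show p' + 2 - 1 = p' + 1 from rfl]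
    have hdom := wtBudget_dominates_biGraded he1 hκ0 hAbar1 (abs_nonneg U) hP.1 hCE p'
    -- `CE^{p'+2}(Klam|U|)^{p'+1} ≤ A₀·(CE^{p'+2}·ε_1^{p'+1}·2^{(3(p'+2)−5)})`
    refine hdom.trans ?_
    have hε : (P.Klam * |U|) ^ (p' + 1) ≤ epsCoupling P U 1 ^ (p' + 1) :=
      pow_le_pow_left₀ (by positivity) (klam_abs_le_epsCoupling_one hKl0 U) _
    have hz : (1 : ℝ) ≤ (2 : ℝ) ^ ((3 * ((p' + 2 : ℕ) : ℤ) - 5) * ((1 : ℕ) : ℤ)) :=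
      one_le_zpow₀ (by norm_num) (by push_cast; omega)
    have hε0 : 0 ≤ epsCoupling P U 1 ^ (p' + 1) := pow_nonneg (epsCoupling_nonneg' hKl0 U 1) _
    calc Q.CE ^ (p' + 2) * (P.Klam * |U|) ^ (p' + 1) ≤ Q.CE ^ (p' + 2) * epsCoupling P U 1 ^ (p' + 1) :=
          mul_le_mul_of_nonneg_left hε (by positivity)
      _ = 1 * (Q.CE ^ (p' + 2) * epsCoupling P U 1 ^ (p' + 1) * 1) := by ring
      _ ≤ A₀ * (Q.CE ^ (p' + 2) * epsCoupling P U 1 ^ (p' + 1) * (2 : ℝ) ^ ((3 * ((p' + 2 : ℕ) : ℤ) - 5) * ((1 : ℕ) : ℤ))) := by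
          gcongr
  have hfull := srcPinnedSumW_one_of_doors hCT0 hCT hc₂ P R c hP hR hc hc₆ μ hμ U hU hU₆ β hβ hβc K hK L M hL hM hAbar hθ1 hθ2
    N hNodd hN2 hNp
  intro m q w S hS
  change _ ≤ N m
  refine le_trans ?_ (hfull m q w)
  refine mul_le_mul_of_nonneg_left (Finset.sum_le_sum_of_subset_of_nonneg hS fun X _ _ => ?_) (pow_nonneg (imagTimeWeight_nonneg hβ0.le M) _)
  exact mul_nonneg (zero_le_one.trans (one_le_klScaleWt L M β 0 _)) (norm_nonneg _)

/-! ## §3 The packaged frame-generic `∃` form (the quantifier order of the atom) -/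

/-- **HUV-W LEVEL 0, PACKAGED** — for every `P R` (well-formed) there are a `CE`-threshold `CE₀ ≥ 0` and doors `c₀`, `U₀` such that in the regime, with an
L-free amplitude `A₀ ≥ 1` chosen after `β`, at every volume above `(klEngL₃, klEngM₃)`, for EVERY admissible frame `K` (`FrameOK R U (nScales β) μ K`) and
every package `Q` with `CE₀ ≤ Q.CE`: every sub-sum of the windowed level-`0` pinned fibre of `𝒱_1[K]` is within `klSrcBudget P Q U (fun _ _ => A₀) 1 s m`.
(`A₀`, the thresholds and `CE₀` do not depend on `K`; the VL producer takes `K := K_top` with `FrameOK` from its tower hypothesis.)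
[cite: BenfattoGiulianiMastropietro2006, §2.9 (4.3)–(4.8), §3 (3.2)–(3.8)] -/
theorem exists_srcPinnedSumW_one_klSrcBudget (P : SplitConsts) (R : RenConsts) (hP : P.WF) (hR : R.WF2) :
    ∃ CE₀ : ℝ, 0 ≤ CE₀ ∧ ∃ c₀ : ℝ, 0 < c₀ ∧ ∀ c : ℝ, 0 < c → c ≤ c₀ → ∃ U₀ : ℝ, 0 < U₀ ∧
      ∀ μ ∈ klWindowC, ∀ U : ℝ, 0 < U → U ≤ U₀ → ∀ β : ℝ, klBetaMin ≤ β → β ≤ Real.exp (c / U ^ 2) →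
        ∃ A₀ : ℝ, 1 ≤ A₀ ∧ ∀ (L M : ℕ) [NeZero L] [NeZero M], klEngL₃ β U ≤ L → klEngM₃ β U L ≤ M →
          ∀ K : TrigPolyC4v, FrameOK R U (nScales β) μ K → ∀ Q : EngConsts, CE₀ ≤ Q.CE →
            ∀ (s m : ℕ) (q : Fin m) (w : SrcLabel L M 0) (S : Finset (Fin m → SrcLabel L M 0)),
              S ⊆ univ.filter (fun X : Fin m → SrcLabel L M 0 => X q = w) →
              imagTimeWeight β M ^ (m - 1) *
                ∑ X ∈ S, klScaleWt L M β 0 ((univ.image X).image (srcLegPos L M (2 * (2 * M)))) *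
                    ‖kernel ℂ (ExteriorAlgebra.map (Matrix.toLin' (klSrcAnalysisAtW L M β μ K 0)) (klEffectiveAction L M β U μ K klE0 1)) m X‖ ≤
                klSrcBudget P Q U (fun _ _ => A₀) 1 s m := by
  obtain ⟨C_T, hCT0, hCT⟩ := exists_timeMomentConst_klAnisoFamily_zero
  obtain ⟨c₂, hc₂⟩ := exists_abs_iteratedDeriv_two_srcWindowFn_le
  obtain ⟨D₁, hD₁, hbr⟩ := exists_abarOne_le
  have hRwf : R.WF := hR.wf
  have hG : ∀ j, 0 ≤ R.Gfr j := hRwf.2.2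
  have hX0 : 0 ≤ klE4X0 := uvSpaceMomentConst_nonneg _ _ _
  have he1 : 1 ≤ Real.exp 1 := Real.one_le_exp (by norm_num)
  have h4 : 0 < Real.log 4 := Real.log_pos (by norm_num)
  have hKF := one_le_klE4KapF R
  -- the R-keyed bracket majorant `Ā := D₁·(1 + ΣGfr)⁴ ≥ 1`
  set g : ℝ := (1 + R.Gfr 0 + R.Gfr 1 + R.Gfr 2 + R.Gfr 3) ^ 4 with hg
  have hg1 : 1 ≤ g := by
    rw [hg]
    have : (1 : ℝ) ≤ 1 + R.Gfr 0 + R.Gfr 1 + R.Gfr 2 + R.Gfr 3 := by linarith [hG 0, hG 1, hG 2, hG 3]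
    exact one_le_pow₀ this
  set Abar : ℝ := D₁ * g with hAbarD
  have hAbar1 : 1 ≤ Abar := one_le_mul_of_one_le_of_one_le hD₁ hg1
  have hAbarpos : 0 < Abar := lt_of_lt_of_le one_pos hAbar1
  have hAbar0 : 0 ≤ Abar := hAbarpos.le
  set κ₁ : ℝ := Real.sqrt (2 * (7 + 6047)) + Real.sqrt 6047 with hκ₁
  have hκ₁1 : 1 ≤ κ₁ ^ 2 := by
    have h1 : (1 : ℝ) ≤ Real.sqrt (2 * (7 + 6047)) := by
      rw [show (1 : ℝ) = Real.sqrt 1 by simp]; exact Real.sqrt_le_sqrt (by norm_num)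
    have h2 : 0 ≤ Real.sqrt 6047 := Real.sqrt_nonneg _
    have h3 : (1 : ℝ) ≤ κ₁ := by rw [hκ₁]; linarith
    exact one_le_pow₀ h3
  have hκ₁pos : 0 < κ₁ := by
    rw [hκ₁]; exact add_pos_of_pos_of_nonneg (Real.sqrt_pos.2 (by norm_num)) (Real.sqrt_nonneg _)
  have hKFpos : 0 < klE4KapF R := lt_of_lt_of_le one_pos hKF
  have hMom1 : 0 < klE4Mom R + 1 := by have := klE4Mom_nonneg R; linarith
  set tW : ℝ := 2 * klIsoT + C_T + 8 * (klE4X0 + 1) + (2 + 72 * c₂) with htW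
  -- the CE threshold
  refine ⟨32 * Real.exp 1 ^ 9 * tW ^ 2 * Abar, by positivity, ?_⟩
  -- the c-door
  set c₀ : ℝ := min (klEngC₃6 P R) (Real.log 4 / (128 * Real.exp 1 ^ 5 * Abar * (klE4Mom R + 1))) with hc₀
  refine ⟨c₀, lt_min (klEngC₃6_pos P R) (by positivity), fun c hc hcc₀ => ?_⟩
  have hc₆ : c ≤ klEngC₃6 P R := hcc₀.trans (min_le_left _ _)
  have hcd' : c ≤ Real.log 4 / (128 * Real.exp 1 ^ 5 * Abar * (klE4Mom R + 1)) := hcc₀.trans (min_le_right _ _)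
  have hcd : 128 * Real.exp 1 ^ 5 * Abar * (klE4Mom R + 1) * (c / Real.log 4) ≤ 1 := by
    have hden : 0 < 128 * Real.exp 1 ^ 5 * Abar * (klE4Mom R + 1) := by positivity
    rw [le_div_iff₀ hden] at hcd'
    rw [show 128 * Real.exp 1 ^ 5 * Abar * (klE4Mom R + 1) * (c / Real.log 4) =
      128 * Real.exp 1 ^ 5 * Abar * (klE4Mom R + 1) * c / Real.log 4 by ring, div_le_one h4]
    linarith
  -- the U-door
  set U₀ : ℝ := min (klEngU₀6 P R c) (1 / (128 * Real.exp 1 ^ 9 * κ₁ ^ 2 * Abar * klE4KapF R)) with hU₀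
  refine ⟨U₀, lt_min (klEngU₀6_pos P R c) (by positivity), fun μ hμ U hU hUU₀ β hβ hβc => ?_⟩
  have hU₆ : U ≤ klEngU₀6 P R c := hUU₀.trans (min_le_left _ _)
  have hUd' : U ≤ 1 / (128 * Real.exp 1 ^ 9 * κ₁ ^ 2 * Abar * klE4KapF R) := hUU₀.trans (min_le_right _ _)
  have hUd : 128 * Real.exp 1 ^ 9 * κ₁ ^ 2 * Abar * klE4KapF R * U ≤ 1 := by
    have hden : 0 < 128 * Real.exp 1 ^ 9 * κ₁ ^ 2 * Abar * klE4KapF R := by positivity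
    rw [le_div_iff₀ hden] at hUd'; linarith
  obtain ⟨hθ1, hθ2⟩ := thetaW_smallness_of_le (cl := c / Real.log 4) he1 hκ₁1 hAbar0 hKF hU (div_nonneg hc.le h4.le) hUd hcd
  have hU₀3 : U ≤ klEngU₀3 P R c := hU₆.trans (klEngU₀6_le_klEngU₀3 P R c)
  have hU1 : |U| ≤ 1 := abs_le_one_of_le_klEngU₀3 hU hU₀3
  have hcD : c ≤ klE4C₃ R := hc₆.trans (klEngC₃6_le_klE4C₃ P R)
  have hN := nScales_succ_mul_sq_le (U := U) hc.le hβ hβc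
  have hhalf := div_log_four_le_half_of_door hcD
  -- the amplitude
  set A₀ : ℝ := max 1 (2 * tW ^ 2 * (Real.exp 1 ^ 5 * (klE4KapF R * |U| + 2 * (c / Real.log 4) * klE4Mom R) + 4 * Real.exp 1 ^ 9 * κ₁ ^ 2 * |U|))
    with hA₀
  refine ⟨A₀, le_max_left _ _, fun L M _ _ hL hM K hK Q hQ s m q w S hS => ?_⟩
  have hAbar := (hbr R U (nScales β) hRwf hU1 (hN.trans hhalf)).trans (le_of_eq hAbarD.symm)
  exact srcPinnedSumW_one_klSrcBudget_of_le_CE hCT0 hCT hc₂ P R c hP hR hc hc₆ μ hμ U hU hU₆ β hβ hβc K hK L M hL hM hAbar1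
    hAbar hθ1 hθ2 Q hQ (A₀ := A₀) le_rfl s m q w S hS

end Summit.HubbardSuperconductivity.HubbardSuperconductivity.Theorems.EngineV8

end
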